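import Literature.AnabelianGeometry.EtaleTheta.FrobenioidRootTransport
import Literature.AnabelianGeometry.EtaleTheta.Discharge.Sec5UnitsTransport
import Literature.AnabelianGeometry.EtaleTheta.Discharge.Sec5Thm510i

/-!
# [EtTh] §5, Theorem 5.7 at the `N`-th root: the transport up to a unit, derived, and the rigidity clause isolated (pp. 329–330 / PDF pp. 103–104)

Mochizuki, *The étale theta function …*, Publ. RIMS **45** (2009)
[cite: MochizukiEtTh2009, Thm 5.7 p.329–330 (PDF pp.103–104)].  Seat abc-iut-L2-d4 (wave-3 discharge of node
`EtTh:Thm5.7`); PROOF-ONLY (no `def`), over abc-iut-L2-t4's `FrobenioidRootTransport.lean` (`RootTransport`,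
`ThetaRootPreserved` = Theorem 5.7 read at the `N`-th root `(s^⊓_N, s^⊔_N)`, the form Theorem 5.10 (ii)
consumes — registered facts F-0548/F-0550) and this seat's `Discharge/Sec5UnitsTransport.lean`.

**What is proved here.**
(A) *Transport up to a unit* — the step of the proof of Theorem 5.6 (p.329 (PDF p.103)) that Remark 5.7.1
(p.330 (PDF p.104)) contrasts with Theorem 5.7: "since `Ψ` preserves pre-steps … and induces a 1-compatible
self-equivalence `Ψ^bs` … it follows that `Ψ` maps this pair of base-equivalent pre-steps to a pair of
base-equivalent pre-steps … Moreover, since `Ψ` [essentially] preserves the divisor of zeroes and poles of `Θ̈`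
[cf. Proposition 5.3, (vi)], it follows [cf. the equivalences of categories involving pre-steps of [FrdI],
Definition 1.3, (iii), (d)] that there exist isomorphisms `γ₁ : S₁ ⥲ T₁`, `γ₂ : S₂ ⥲ T₂`, `u ∈ O^×(T₂)` such that
`γ₂ ∘ s^⊓ = t^⊓ ∘ γ₁`, `u ∘ γ₂ ∘ s^⊔ = t^⊔ ∘ γ₁`."  DERIVED (`exists_codTransport_of_div_eq`): for the transported
pair `t^⊓ := α⁻¹ ≫ Ψ(s^⊓_N) ≫ β`, `t^⊔ := α⁻¹ ≫ Ψ(s^⊔_N) ≫ β` and an automorphism `e` of `A_N` matching zero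
divisors (the reading of Prop. 5.3 (vi) at `A_N`, hypothesis `h⊓`/`h⊔`), there are UNIQUE `D_c, D_p ∈ Aut_C(B_N)`
with `t^⊓ = e ≫ s^⊓_N ≫ D_c`, `t^⊔ = e ≫ s^⊔_N ≫ D_p`, and `u := D_c⁻¹ · D_p ∈ O^×(B_N)` — from the LITERAL
[FrdI] inputs: `C` totally epimorphic ([FrdI] Def. 1.3), of isotropic type ([EtTh] Thm. 3.7 (i), whence every
pre-step is co-angular, [FrdI] Prop. 1.4 (i)), Def. 1.3 (iii)(d) (coslice, full), "`Ψ` preserves pre-steps"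
([FrdI] Thm. 3.4 (ii) via Prop. 5.1) and "`Ψ` preserves base-equivalent pairs" (from a 1-compatible `Ψ^bs`,
`baseEquivalent_map_of_compat`).
(B) *Theorem 5.7 proper* is the RIGIDITY of that unit: "up to possible multiplication by a `2l`-th root of
unity" = `u ∈ μ_{2l·N}(B_N) ∩ (O_K^×)^{1/N}` at level `N` (proof, p.330 (PDF p.104): "by considering compatible
systems as in Remark 4.3.2 and applying the theory of the rigidity of the étale theta function [cf. Corollary
2.8, (i)], to the Kummer classes of Proposition 5.2, (iii) [cf. also Theorem 4.4, (iii); Proposition 5.3, (vi)],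
in light of the crucial isomorphisms … of Proposition 5.5, which, by Theorem 5.6, are preserved by `Ψ`").  This
clause is carried as the NAMED HYPOTHESIS `hrig` (`rootTransport_of_unit`, `rootTransport_of`,
`thetaRootPreserved_of`).  FINDING (reported to abc-iut-L2-lead, not a side taken): it is NOT derivable from the
level-`N` §5 data `ThetaFrobenioid` (one fixed `N`) together with the level-`N` forms of the cited inputs — for
a unit `v ∈ O^×(B_N)` fixed by the conjugation action of `Aut_C(B_N)` (a constant of the base field), the pairs
`(s^⊓_N, s^⊔_N)` and `(s^⊓_N, s^⊔_N · v)` have the SAME bi-Kummer `N`-th root `(s^⊓-gp_N, s^⊔-gp_N)`, hence the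
same mod-`N` Kummer class; the printed proof separates them only through "compatible systems as in Remark
4.3.2", i.e. the roots at ALL levels, which the fixed-`N` structure does not carry (merge debt of W2-L2-05).
(The consumer edge Thm. 5.7 → Thm. 5.10 (ii)(iii) by name — `psiAutPreserves_of` fed with the witnesses-exposed
form `RootTransportWith`, abc-iut-L2-t4's v2 append p411375 — is abc-iut-L2-t4's staged
`Discharge/Sec5Thm510OfRootTransport.lean`; it is not duplicated here.)
HONEST FRAMING: kernel-checked implications between typed statements about the §5 data; nothing here asserts
a result of [EtTh] unconditionally; typed ≠ discharged; no side is taken on anything downstream. -/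

namespace Literature.AnabelianGeometry.EtaleTheta

open CategoryTheory
open Literature.AlgebraicGeometry.Frobenioids

universe w v v' u u'

namespace ThetaFrobenioid

variable {C : Type u} [Category.{v} C] {D : Type u'} [Category.{v'} D] {𝔉 : ThetaFrobenioid.{w} C D}

/-! ### [FrdI]-level lemmas over the operations `(Base, Div, deg_Fr)` of `C` -/

/-- In a (pre-)Frobenioid of isotropic type every arrow is co-angular ([FrdI] Prop. 1.4 (i) "follows
formally from the definitions"; [EtTh] Thm. 3.7 (i): the tempered Frobenioid `C` "is of isotropic … type",
whence "the (necessarily co-angular) pre-steps", Cor. 3.8 proof p.307 (PDF p.81)).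
[cite: MochizukiEtTh2009, Thm 3.7 (i) p.305 (PDF p.79)] -/
theorem isCoAngular_of_isOfIsotropicType (hiso : 𝔉.pre.IsOfIsotropicType) {A B : C} (φ : A ⟶ B) :
    𝔉.pre.IsCoAngular φ := by
  intro X Y γ β _ _ _ hβ _
  exact hiso.obj X β hβ

/-- Pre-steps are stable under postcomposition with an isomorphism ([FrdI] Def. 1.2 (iii), Rmk. 1.1.1).
[cite: MochizukiEtTh2009, Thm 5.6 proof p.329 (PDF p.103)] -/
theorem isPreStep_comp_iso_hom {A B B' : C} {φ : A ⟶ B} (hφ : 𝔉.IsPreStep φ) (i : B ≅ B') :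
    𝔉.IsPreStep (φ ≫ i.hom) := by
  refine ⟨?_, ?_⟩
  · change 𝔉.pre.degFr (φ ≫ i.hom) = 1
    rw [𝔉.pre.degFr_comp, show 𝔉.pre.degFr φ = 1 from hφ.1, one_mul]
    exact isLinear_iso_hom i
  · change IsIso (𝔉.base.map (φ ≫ i.hom))
    haveI : IsIso (𝔉.base.map φ) := hφ.2
    rw [Functor.map_comp]
    infer_instance

/-- The transported arrow `α⁻¹ ≫ Ψ(s) ≫ β` of a pre-step `s` is a pre-step, when "`Ψ` preserves pre-steps"
([FrdI] Thm. 3.4 (ii), via Prop. 5.1; proof of Thm. 5.6 p.329 (PDF p.103)).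
[cite: MochizukiEtTh2009, Thm 5.6 proof p.329 (PDF p.103)] -/
theorem isPreStep_transport (Ψ : C ≌ C)
    (hpre : PreFrobenioidData.PreservesMor Ψ.functor 𝔉.IsPreStep 𝔉.IsPreStep)
    {A B A' B' : C} {s : A ⟶ B} (hs : 𝔉.IsPreStep s) (α : Ψ.functor.obj A ≅ A')
    (β : Ψ.functor.obj B ≅ B') : 𝔉.IsPreStep (α.inv ≫ Ψ.functor.map s ≫ β.hom) :=
  isPreStep_iso_hom_comp α.symm (isPreStep_comp_iso_hom (hpre s hs) β)

/-- **Rigidity of pre-steps under `A`** — the consequence of [FrdI] Def. 1.3 (iii)(d) ("the natural functor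
`^A(C^coa-pre) → Order(Φ(A))` [zero divisor] is an equivalence of categories") used on p.329 (PDF p.103): two
pre-steps out of `A` with EQUAL zero divisors are isomorphic under `A`, by an isomorphism compatible with the
two arrows.  DERIVED from the literal clause "(iii)(d), coslice, full" (`hiiid`, the shape of the cell's
`IsFrobenioid.iii_d_under_full`), the co-angularity of pre-steps (`C` of isotropic type, [EtTh] Thm. 3.7 (i))
and total epimorphicity ([FrdI] Def. 1.3).  [cite: MochizukiEtTh2009, Thm 5.6 proof p.329 (PDF p.103)] -/
theorem exists_iso_of_div_eq (hepi : ∀ ⦃X Y : C⦄ (f : X ⟶ Y), Epi f) (hiso : 𝔉.pre.IsOfIsotropicType)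
    (hiiid : ∀ ⦃A B B' : C⦄ (φ : A ⟶ B) (φ' : A ⟶ B'), 𝔉.pre.IsCoAngularPreStep φ →
      𝔉.pre.IsCoAngularPreStep φ' → 𝔉.pre.div φ ∣ 𝔉.pre.div φ' →
        ∃ f : B ⟶ B', 𝔉.pre.IsCoAngularPreStep f ∧ φ ≫ f = φ')
    {A B B' : C} {φ : A ⟶ B} {φ' : A ⟶ B'} (hφ : 𝔉.IsPreStep φ) (hφ' : 𝔉.IsPreStep φ')
    (h : 𝔉.pre.div φ = 𝔉.pre.div φ') : ∃ f : B ≅ B', φ ≫ f.hom = φ' := by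
  have hc : 𝔉.pre.IsCoAngularPreStep φ := ⟨isCoAngular_of_isOfIsotropicType hiso φ, hφ⟩
  have hc' : 𝔉.pre.IsCoAngularPreStep φ' := ⟨isCoAngular_of_isOfIsotropicType hiso φ', hφ'⟩
  obtain ⟨f, -, hf⟩ := hiiid φ φ' hc hc' (by rw [h])
  obtain ⟨g, -, hg⟩ := hiiid φ' φ hc' hc (by rw [h])
  haveI := hepi φ
  haveI := hepi φ'
  have h1 : f ≫ g = 𝟙 B := by
    rw [← cancel_epi φ, ← Category.assoc, hf, hg, Category.comp_id]
  have h2 : g ≫ f = 𝟙 B' := by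
    rw [← cancel_epi φ', ← Category.assoc, hg, hf, Category.comp_id]
  exact ⟨⟨f, g, h1, h2⟩, hf⟩

/-- "`Ψ` … induces a 1-compatible self-equivalence `Ψ^bs`" ⇒ "`Ψ` maps [a] pair of base-equivalent pre-steps to
a pair of base-equivalent pre-steps" (proof of Thm. 5.6, p.329 (PDF p.103); [FrdI] Thm. 3.4 (v)): from a natural
isomorphism `Ψ ⋙ Base ≅ Base ⋙ Ψ^bs`.  [cite: MochizukiEtTh2009, Thm 5.6 proof p.329 (PDF p.103)] -/
theorem baseEquivalent_map_of_compat (Ψ : C ≌ C) (Ψbs : D ⥤ D) (eΨ : Ψ.functor ⋙ 𝔉.base ≅ 𝔉.base ⋙ Ψbs)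
    {A B : C} {φ ψ : A ⟶ B} (h : 𝔉.pre.BaseEquivalent φ ψ) :
    𝔉.pre.BaseEquivalent (Ψ.functor.map φ) (Ψ.functor.map ψ) := by
  change (Ψ.functor ⋙ 𝔉.base).map φ = (Ψ.functor ⋙ 𝔉.base).map ψ
  rw [← NatIso.naturality_2 eΨ φ, ← NatIso.naturality_2 eΨ ψ]
  change eΨ.hom.app A ≫ Ψbs.map (𝔉.base.map φ) ≫ eΨ.inv.app B =
    eΨ.hom.app A ≫ Ψbs.map (𝔉.base.map ψ) ≫ eΨ.inv.app B
  rw [show 𝔉.base.map φ = 𝔉.base.map ψ from h]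

/-! ### (A) Transport of the root up to a unit (proof of Thm. 5.6, p. 329; Rmk. 5.7.1) -/

section UnitTransport

variable (Ψ : C ≌ C) (α : Ψ.functor.obj 𝔉.AN ≅ 𝔉.AN) (β : Ψ.functor.obj 𝔉.BN ≅ 𝔉.BN)

/-- The codomain isomorphism is UNIQUE: `e ≫ s ≫ D = e ≫ s ≫ D'` forces `D = D'` (`e ≫ s` is an epimorphism —
`C` is totally epimorphic, [FrdI] Def. 1.3).  [cite: MochizukiEtTh2009, Thm 5.6 proof p.329 (PDF p.103)] -/
theorem aut_eq_of_comp_eq {s : 𝔉.AN ⟶ 𝔉.BN} [Epi s] (e : 𝔉.AN ≅ 𝔉.AN) {Dm Dm' : Aut 𝔉.BN}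
    (h : e.hom ≫ s ≫ Dm.hom = e.hom ≫ s ≫ Dm'.hom) : Dm = Dm' :=
  Aut.ext ((cancel_epi s).mp ((cancel_epi e.hom).mp h))

/-- **Transport up to a unit** (the step of the proof of Theorem 5.6, p.329 (PDF p.103), that Remark 5.7.1,
p.330 (PDF p.104), compares Theorem 5.7 with).  For the self-equivalence `Ψ`, isomorphisms `α : Ψ(A_N) ⥲ A_N`,
`β : Ψ(B_N) ⥲ B_N` [Thm. 5.10 (i)] and an automorphism `e` of `A_N` under which the transported sections
`t^⊓ := α⁻¹ ≫ Ψ(s^⊓_N) ≫ β`, `t^⊔ := α⁻¹ ≫ Ψ(s^⊔_N) ≫ β` have the zero divisors of `e ≫ s^⊓_N`, `e ≫ s^⊔_N`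
("`Ψ` [essentially] preserves the divisor of zeroes and poles of `Θ̈` [cf. Proposition 5.3, (vi)]" — the
`Aut_C`-orbit clause of Prop. 5.3 (vi), p.326 (PDF p.100), read at the `N`-domain `A_N`: hypotheses `hcap`, `hcup`),
there exist `D_c, D_p ∈ Aut_C(B_N)` with `t^⊓ = e ≫ s^⊓_N ≫ D_c`, `t^⊔ = e ≫ s^⊔_N ≫ D_p` ("there exist
isomorphisms `γ₁`, `γ₂` … such that `γ₂ ∘ s^⊓ = t^⊓ ∘ γ₁`, `u ∘ γ₂ ∘ s^⊔ = t^⊔ ∘ γ₁`") and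
`D_c⁻¹ · D_p ∈ O^×(B_N)` (the "`u ∈ O^×(T₂)`").  Inputs, as printed: `C` totally epimorphic ([FrdI] Def. 1.3)
and of isotropic type ([EtTh] Thm. 3.7 (i)); [FrdI] Def. 1.3 (iii)(d) (coslice, full); "`Ψ` preserves pre-steps"
([FrdI] Thm. 3.4 (ii) via Prop. 5.1); "`Ψ` preserves base-equivalent pairs" (1-compatible `Ψ^bs`,
`baseEquivalent_map_of_compat`).  [cite: MochizukiEtTh2009, Thm 5.6 proof p.329 (PDF p.103); Rmk 5.7.1 p.330 (PDF p.104)] -/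
theorem exists_codTransport_of_div_eq (hepi : ∀ ⦃X Y : C⦄ (f : X ⟶ Y), Epi f)
    (hiso : 𝔉.pre.IsOfIsotropicType)
    (hiiid : ∀ ⦃A B B' : C⦄ (φ : A ⟶ B) (φ' : A ⟶ B'), 𝔉.pre.IsCoAngularPreStep φ →
      𝔉.pre.IsCoAngularPreStep φ' → 𝔉.pre.div φ ∣ 𝔉.pre.div φ' →
        ∃ f : B ⟶ B', 𝔉.pre.IsCoAngularPreStep f ∧ φ ≫ f = φ')
    (hpre : PreFrobenioidData.PreservesMor Ψ.functor 𝔉.IsPreStep 𝔉.IsPreStep)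
    (hbe : ∀ ⦃A B : C⦄ (φ ψ : A ⟶ B), 𝔉.pre.BaseEquivalent φ ψ →
      𝔉.pre.BaseEquivalent (Ψ.functor.map φ) (Ψ.functor.map ψ))
    (e : 𝔉.AN ≅ 𝔉.AN)
    (hcap : 𝔉.pre.div (α.inv ≫ Ψ.functor.map 𝔉.sCap ≫ β.hom) = 𝔉.pre.div (e.hom ≫ 𝔉.sCap))
    (hcup : 𝔉.pre.div (α.inv ≫ Ψ.functor.map 𝔉.sCup ≫ β.hom) = 𝔉.pre.div (e.hom ≫ 𝔉.sCup)) :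
    ∃ Dc Dp : Aut 𝔉.BN,
      α.inv ≫ Ψ.functor.map 𝔉.sCap ≫ β.hom = e.hom ≫ 𝔉.sCap ≫ Dc.hom ∧
      α.inv ≫ Ψ.functor.map 𝔉.sCup ≫ β.hom = e.hom ≫ 𝔉.sCup ≫ Dp.hom ∧
      Dc⁻¹ * Dp ∈ 𝔉.units 𝔉.BN := by
  obtain ⟨Dc, hDc⟩ := exists_iso_of_div_eq hepi hiso hiiid
    (isPreStep_iso_hom_comp e 𝔉.isPreStep_sCap) (isPreStep_transport Ψ hpre 𝔉.isPreStep_sCap α β)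
    hcap.symm
  obtain ⟨Dp, hDp⟩ := exists_iso_of_div_eq hepi hiso hiiid
    (isPreStep_iso_hom_comp e 𝔉.isPreStep_sCup) (isPreStep_transport Ψ hpre 𝔉.isPreStep_sCup α β)
    hcup.symm
  rw [Category.assoc] at hDc hDp
  refine ⟨Dc, Dp, hDc.symm, hDp.symm, ?_⟩
  -- `u := D_c⁻¹ · D_p` is base-identity, hence a unit (`O^×(B_N) = Ker(Aut_C(B_N) → Aut_D(B_N^bs))`)
  rw [𝔉.units_eq_ker, MonoidHom.mem_ker, map_mul, map_inv, inv_mul_eq_one]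
  apply Aut.ext
  change 𝔉.base.map Dc.hom = 𝔉.base.map Dp.hom
  have hbase : 𝔉.base.map (α.inv ≫ Ψ.functor.map 𝔉.sCap ≫ β.hom) =
      𝔉.base.map (α.inv ≫ Ψ.functor.map 𝔉.sCup ≫ β.hom) := by
    have h := hbe 𝔉.sCap 𝔉.sCup 𝔉.base_map_sCap
    change 𝔉.base.map (Ψ.functor.map 𝔉.sCap) = 𝔉.base.map (Ψ.functor.map 𝔉.sCup) at h
    simp only [Functor.map_comp, h]
  rw [← hDc, ← hDp] at hbase
  simp only [Functor.map_comp] at hbase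
  rw [← 𝔉.base_map_sCap] at hbase
  haveI : IsIso (𝔉.base.map 𝔉.sCap) := 𝔉.isPreStep_sCap.2
  exact (cancel_epi _).mp ((cancel_epi _).mp hbase)

end UnitTransport

/-! ### (B) Theorem 5.7 at the `N`-th root, modulo the rigidity of the unit -/

section RootTransport

variable (Ψ : C ≌ C) (α : Ψ.functor.obj 𝔉.AN ≅ 𝔉.AN) (β : Ψ.functor.obj 𝔉.BN ≅ 𝔉.BN)

/-- `RootTransport Ψ α β` from the two transport equations for SOME `(e, D_c, D_p)` and the RIGIDITY of the unit
`u := D_c⁻¹ · D_p`: "up to possible multiplication by a `2l`-th root of unity" (Thm. 5.7, p.330 (PDF p.104)), at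
level `N`: `u ∈ μ_{2l·N}(B_N) ∩ (O_K^×)^{1/N}` — hypothesis `hrig`, the content of the printed proof of Thm. 5.7
("compatible systems as in Remark 4.3.2 … rigidity of the étale theta function [cf. Corollary 2.8, (i)] … Kummer
classes of Proposition 5.2, (iii) [cf. also Theorem 4.4, (iii); Proposition 5.3, (vi)] … Proposition 5.5 …
Theorem 5.6"); the "translation by an element of … `l·ℤ`" enters with `δ₃ = 1` (it is absorbed by `D_c`, cf.
`Sec5Thm510ii.psiAutPreserves_of`, where `D_c = δ₁ · s^⊓-gp_N(D_c^bs)`).  (With abc-iut-L2-t4's v2 append the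
same term proves the witnesses-exposed `RootTransportWith Ψ α β e D_c D_p`.)
[cite: MochizukiEtTh2009, Thm 5.7 p.329–330 (PDF pp.103–104)] -/
theorem rootTransport_of_unit {e : 𝔉.AN ≅ 𝔉.AN} {Dc Dp : Aut 𝔉.BN}
    (hT : α.inv ≫ Ψ.functor.map 𝔉.sCap ≫ β.hom = e.hom ≫ 𝔉.sCap ≫ Dc.hom)
    (hT' : α.inv ≫ Ψ.functor.map 𝔉.sCup ≫ β.hom = e.hom ≫ 𝔉.sCup ≫ Dp.hom)
    (hrig : Dc⁻¹ * Dp ∈ 𝔉.muTorsion 𝔉.BN (2 * 𝔉.l * 𝔉.N) ⊓ 𝔉.OKxRootN) :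
    𝔉.RootTransport Ψ α β :=
  ⟨e, Dc, Dp, hT, hT', Dc⁻¹ * Dp, hrig, 1, one_mem _, (mul_one _).symm⟩

/-- **[EtTh] Theorem 5.7 at the `N`-th root (`RootTransport Ψ α β`), discharged modulo its printed inputs.**
Hypotheses: (A) as in `exists_codTransport_of_div_eq` — `C` totally epimorphic and of isotropic type ([FrdI]
Def. 1.3; [EtTh] Thm. 3.7 (i)), [FrdI] Def. 1.3 (iii)(d), "`Ψ` preserves pre-steps" and base-equivalent pairs
([FrdI] Thm. 3.4 (ii), (v) via Prop. 5.1), and Prop. 5.3 (vi) read at `A_N` (`hdiv`: one automorphism `e` of `A_N`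
matching the zero divisors of both transported sections); (B) the rigidity of the resulting unit (`hrig`: for the
`D_c, D_p` so obtained, `D_c⁻¹ · D_p ∈ μ_{2l·N}(B_N) ∩ (O_K^×)^{1/N}` — Cor. 2.8 (i) through Rmk. 4.3.2, Prop. 5.2
(iii), Thm. 4.4 (iii), Prop. 5.5/Thm. 5.6; NOT derivable from the level-`N` data, see the module docstring).
[cite: MochizukiEtTh2009, Thm 5.7 p.329–330 (PDF pp.103–104)] -/
theorem rootTransport_of (hepi : ∀ ⦃X Y : C⦄ (f : X ⟶ Y), Epi f) (hiso : 𝔉.pre.IsOfIsotropicType)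
    (hiiid : ∀ ⦃A B B' : C⦄ (φ : A ⟶ B) (φ' : A ⟶ B'), 𝔉.pre.IsCoAngularPreStep φ →
      𝔉.pre.IsCoAngularPreStep φ' → 𝔉.pre.div φ ∣ 𝔉.pre.div φ' →
        ∃ f : B ⟶ B', 𝔉.pre.IsCoAngularPreStep f ∧ φ ≫ f = φ')
    (hpre : PreFrobenioidData.PreservesMor Ψ.functor 𝔉.IsPreStep 𝔉.IsPreStep)
    (hbe : ∀ ⦃A B : C⦄ (φ ψ : A ⟶ B), 𝔉.pre.BaseEquivalent φ ψ →
      𝔉.pre.BaseEquivalent (Ψ.functor.map φ) (Ψ.functor.map ψ))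
    (hdiv : ∃ e : 𝔉.AN ≅ 𝔉.AN,
      𝔉.pre.div (α.inv ≫ Ψ.functor.map 𝔉.sCap ≫ β.hom) = 𝔉.pre.div (e.hom ≫ 𝔉.sCap) ∧
      𝔉.pre.div (α.inv ≫ Ψ.functor.map 𝔉.sCup ≫ β.hom) = 𝔉.pre.div (e.hom ≫ 𝔉.sCup))
    (hrig : ∀ (e : 𝔉.AN ≅ 𝔉.AN) (Dc Dp : Aut 𝔉.BN),
      α.inv ≫ Ψ.functor.map 𝔉.sCap ≫ β.hom = e.hom ≫ 𝔉.sCap ≫ Dc.hom →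
      α.inv ≫ Ψ.functor.map 𝔉.sCup ≫ β.hom = e.hom ≫ 𝔉.sCup ≫ Dp.hom →
      Dc⁻¹ * Dp ∈ 𝔉.units 𝔉.BN → Dc⁻¹ * Dp ∈ 𝔉.muTorsion 𝔉.BN (2 * 𝔉.l * 𝔉.N) ⊓ 𝔉.OKxRootN) :
    𝔉.RootTransport Ψ α β := by
  obtain ⟨e, hcap, hcup⟩ := hdiv
  obtain ⟨Dc, Dp, hT, hT', hu⟩ :=
    exists_codTransport_of_div_eq Ψ α β hepi hiso hiiid hpre hbe e hcap hcup
  exact rootTransport_of_unit Ψ α β hT hT' (hrig e Dc Dp hT hT' hu)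

/-- **[EtTh] Theorem 5.7, root-level form for all choices (`ThetaRootPreserved Ψ`)**, modulo the same inputs
stated for every `(α, β)`.  [cite: MochizukiEtTh2009, Thm 5.7 p.329–330 (PDF pp.103–104)] -/
theorem thetaRootPreserved_of (hepi : ∀ ⦃X Y : C⦄ (f : X ⟶ Y), Epi f) (hiso : 𝔉.pre.IsOfIsotropicType)
    (hiiid : ∀ ⦃A B B' : C⦄ (φ : A ⟶ B) (φ' : A ⟶ B'), 𝔉.pre.IsCoAngularPreStep φ →
      𝔉.pre.IsCoAngularPreStep φ' → 𝔉.pre.div φ ∣ 𝔉.pre.div φ' →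
        ∃ f : B ⟶ B', 𝔉.pre.IsCoAngularPreStep f ∧ φ ≫ f = φ')
    (hpre : PreFrobenioidData.PreservesMor Ψ.functor 𝔉.IsPreStep 𝔉.IsPreStep)
    (hbe : ∀ ⦃A B : C⦄ (φ ψ : A ⟶ B), 𝔉.pre.BaseEquivalent φ ψ →
      𝔉.pre.BaseEquivalent (Ψ.functor.map φ) (Ψ.functor.map ψ))
    (hdiv : ∀ (α : Ψ.functor.obj 𝔉.AN ≅ 𝔉.AN) (β : Ψ.functor.obj 𝔉.BN ≅ 𝔉.BN), ∃ e : 𝔉.AN ≅ 𝔉.AN,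
      𝔉.pre.div (α.inv ≫ Ψ.functor.map 𝔉.sCap ≫ β.hom) = 𝔉.pre.div (e.hom ≫ 𝔉.sCap) ∧
      𝔉.pre.div (α.inv ≫ Ψ.functor.map 𝔉.sCup ≫ β.hom) = 𝔉.pre.div (e.hom ≫ 𝔉.sCup))
    (hrig : ∀ (α : Ψ.functor.obj 𝔉.AN ≅ 𝔉.AN) (β : Ψ.functor.obj 𝔉.BN ≅ 𝔉.BN)
      (e : 𝔉.AN ≅ 𝔉.AN) (Dc Dp : Aut 𝔉.BN),
      α.inv ≫ Ψ.functor.map 𝔉.sCap ≫ β.hom = e.hom ≫ 𝔉.sCap ≫ Dc.hom →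
      α.inv ≫ Ψ.functor.map 𝔉.sCup ≫ β.hom = e.hom ≫ 𝔉.sCup ≫ Dp.hom →
      Dc⁻¹ * Dp ∈ 𝔉.units 𝔉.BN → Dc⁻¹ * Dp ∈ 𝔉.muTorsion 𝔉.BN (2 * 𝔉.l * 𝔉.N) ⊓ 𝔉.OKxRootN) :
    𝔉.ThetaRootPreserved Ψ :=
  fun α β => rootTransport_of Ψ α β hepi hiso hiiid hpre hbe (hdiv α β) (hrig α β)

/-- The level-`N` BLINDNESS behind the finding: the bi-Kummer data do not see a unit rescaling of the theta
trivialization by an `Aut_C(B_N)`-central unit.  Precisely: if `v ∈ Aut_C(B_N)` commutes with every value of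
`s^⊔-gp_N`, then `(s^⊔_N ≫ v)` satisfies the SAME defining relation `SgpCupSpec` with the SAME homomorphism
`s^⊔-gp_N` (p.331 (PDF p.105): "`s^⊔-gp_N(h) ∘ s^⊔_N = s^⊔_N ∘ (s^trv_N|_{H_{B_N}})(h)`") — so the pairs
`(s^⊓_N, s^⊔_N)` and `(s^⊓_N, s^⊔_N ≫ v)` have the same bi-Kummer `N`-th root and the same Kummer class mod `N`
(Prop. 5.2 (iii)); only the "compatible systems" over all levels (Rmk. 4.3.2, p.318 (PDF p.92)) of the proof
of Thm. 5.7 distinguish them.  [cite: MochizukiEtTh2009, Thm 5.7 proof p.330 (PDF p.104); Rmk 4.3.2 p.318 (PDF p.92)] -/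
theorem sgpCupSpec_comp_of_central (hcup : 𝔉.SgpCupSpec) (v : Aut 𝔉.BN)
    (hv : ∀ h : 𝔉.HB, 𝔉.sgpCup h * v = v * 𝔉.sgpCup h) (h : 𝔉.HB) :
    (𝔉.sCup ≫ v.hom) ≫ (𝔉.sgpCup h).hom =
      (𝔉.strv (𝔉.autBaseIsoAB.symm (h : Aut (𝔉.base.obj 𝔉.BN)))).hom ≫ (𝔉.sCup ≫ v.hom) := by
  have hvh : v.hom ≫ (𝔉.sgpCup h).hom = (𝔉.sgpCup h).hom ≫ v.hom := by
    have := congrArg Iso.hom (hv h)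
    simpa [Aut.Aut_mul_def] using this
  rw [Category.assoc, hvh, ← Category.assoc, hcup h, Category.assoc]

end RootTransport

/-! ### (A′) Appendix (v2, append-only): the witnesses-exposed form `RootTransportWith` (abc-iut-L2-t4's v2 of
`FrobenioidRootTransport.lean`, p411375) and Theorem 5.10 (i) with [FrdI] Def. 1.3 (iii)(d) read literally -/

section Appendix

variable (Ψ : C ≌ C) (α : Ψ.functor.obj 𝔉.AN ≅ 𝔉.AN) (β : Ψ.functor.obj 𝔉.BN ≅ 𝔉.BN)

/-- `RootTransportWith Ψ α β e D_c D_p` (Thm. 5.7 at the `N`-th root with the Prop. 4.2 (iv) witnesses exposed —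
the shape `Sec5Thm510ii.psiAutPreserves_of` consumes) from the two transport equations and the rigidity of the
unit `u := D_c⁻¹ · D_p` (`hrig`, Thm. 5.7 "up to … a `2l`-th root of unity"), with `δ₃ = 1`.
[cite: MochizukiEtTh2009, Thm 5.7 p.329–330 (PDF pp.103–104)] -/
theorem rootTransportWith_of_unit {e : 𝔉.AN ≅ 𝔉.AN} {Dc Dp : Aut 𝔉.BN}
    (hT : α.inv ≫ Ψ.functor.map 𝔉.sCap ≫ β.hom = e.hom ≫ 𝔉.sCap ≫ Dc.hom)
    (hT' : α.inv ≫ Ψ.functor.map 𝔉.sCup ≫ β.hom = e.hom ≫ 𝔉.sCup ≫ Dp.hom)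
    (hrig : Dc⁻¹ * Dp ∈ 𝔉.muTorsion 𝔉.BN (2 * 𝔉.l * 𝔉.N) ⊓ 𝔉.OKxRootN) :
    𝔉.RootTransportWith Ψ α β e Dc Dp :=
  ⟨hT, hT', Dc⁻¹ * Dp, hrig, 1, one_mem _, (mul_one _).symm⟩

/-- **Theorem 5.7 at the `N`-th root for a GIVEN `e`** (the form in which it composes with Thm. 4.4 (iv)'s
transport of `s^trv_N` through the same `e`, cf. `Sec5Thm510ii.psiAutPreserves_of`): from the inputs of (A)
(`C` totally epimorphic and of isotropic type, [FrdI] Def. 1.3 (iii)(d), Thm. 3.4 (ii), base-equivalence,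
Prop. 5.3 (vi) at `A_N` for this `e`) and the rigidity of the unit for this `e` (`hrig`), there are `D_c, D_p`
with `RootTransportWith Ψ α β e D_c D_p` and `D_c⁻¹ · D_p ∈ O^×(B_N)`.
[cite: MochizukiEtTh2009, Thm 5.7 p.329–330 (PDF pp.103–104); Thm 5.6 proof p.329 (PDF p.103)] -/
theorem exists_rootTransportWith_of_div_eq (hepi : ∀ ⦃X Y : C⦄ (f : X ⟶ Y), Epi f)
    (hiso : 𝔉.pre.IsOfIsotropicType)
    (hiiid : ∀ ⦃A B B' : C⦄ (φ : A ⟶ B) (φ' : A ⟶ B'), 𝔉.pre.IsCoAngularPreStep φ →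
      𝔉.pre.IsCoAngularPreStep φ' → 𝔉.pre.div φ ∣ 𝔉.pre.div φ' →
        ∃ f : B ⟶ B', 𝔉.pre.IsCoAngularPreStep f ∧ φ ≫ f = φ')
    (hpre : PreFrobenioidData.PreservesMor Ψ.functor 𝔉.IsPreStep 𝔉.IsPreStep)
    (hbe : ∀ ⦃A B : C⦄ (φ ψ : A ⟶ B), 𝔉.pre.BaseEquivalent φ ψ →
      𝔉.pre.BaseEquivalent (Ψ.functor.map φ) (Ψ.functor.map ψ))
    (e : 𝔉.AN ≅ 𝔉.AN)
    (hcap : 𝔉.pre.div (α.inv ≫ Ψ.functor.map 𝔉.sCap ≫ β.hom) = 𝔉.pre.div (e.hom ≫ 𝔉.sCap))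
    (hcup : 𝔉.pre.div (α.inv ≫ Ψ.functor.map 𝔉.sCup ≫ β.hom) = 𝔉.pre.div (e.hom ≫ 𝔉.sCup))
    (hrig : ∀ Dc Dp : Aut 𝔉.BN,
      α.inv ≫ Ψ.functor.map 𝔉.sCap ≫ β.hom = e.hom ≫ 𝔉.sCap ≫ Dc.hom →
      α.inv ≫ Ψ.functor.map 𝔉.sCup ≫ β.hom = e.hom ≫ 𝔉.sCup ≫ Dp.hom →
      Dc⁻¹ * Dp ∈ 𝔉.units 𝔉.BN → Dc⁻¹ * Dp ∈ 𝔉.muTorsion 𝔉.BN (2 * 𝔉.l * 𝔉.N) ⊓ 𝔉.OKxRootN) :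
    ∃ Dc Dp : Aut 𝔉.BN, 𝔉.RootTransportWith Ψ α β e Dc Dp ∧ Dc⁻¹ * Dp ∈ 𝔉.units 𝔉.BN := by
  obtain ⟨Dc, Dp, hT, hT', hu⟩ :=
    exists_codTransport_of_div_eq Ψ α β hepi hiso hiiid hpre hbe e hcap hcup
  exact ⟨Dc, Dp, rootTransportWith_of_unit Ψ α β hT hT' (hrig Dc Dp hT hT' hu), hu⟩

/-- **[EtTh] Theorem 5.10 (i), discharged modulo its cited inputs — with the determination of the codomain
by the zero divisor (`hdet` of `Sec5Thm510i.preservesIsoClasses_of`) DERIVED** from the literal [FrdI]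
Def. 1.3 (iii)(d) (coslice, full), `C` of isotropic type ([EtTh] Thm. 3.7 (i)) and total epimorphicity
(`exists_iso_of_div_eq`).  Remaining hypotheses exactly as in `preservesIsoClasses_of`: `A_N` Frobenius-trivial
and `Ψ` preserves Frobenius-trivial objects ([FrdI] Thm. 3.4 via Prop. 5.1), `Ψ(A_N)^bs ≅ A_N^bs` (Prop. 2.4),
[FrdI] Thm. 5.1 (iii) (`h51`), "`Ψ` preserves pre-steps", and the divisor transport at `A_N` (Prop. 5.3 (vi) /
Cor. 3.8 (iii)).  [cite: MochizukiEtTh2009, Thm 5.10 (i) p.333–334 (PDF pp.107–108)] -/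
theorem preservesIsoClasses_of_iiid (hepi : ∀ ⦃X Y : C⦄ (f : X ⟶ Y), Epi f)
    (hiso : 𝔉.pre.IsOfIsotropicType)
    (hiiid : ∀ ⦃A B B' : C⦄ (φ : A ⟶ B) (φ' : A ⟶ B'), 𝔉.pre.IsCoAngularPreStep φ →
      𝔉.pre.IsCoAngularPreStep φ' → 𝔉.pre.div φ ∣ 𝔉.pre.div φ' →
        ∃ f : B ⟶ B', 𝔉.pre.IsCoAngularPreStep f ∧ φ ≫ f = φ')
    (hFT : 𝔉.IsFrobeniusTrivial 𝔉.AN)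
    (hΨFT : PreFrobenioidData.PreservesObj Ψ.functor 𝔉.pre.IsFrobeniusTrivial 𝔉.pre.IsFrobeniusTrivial)
    (hbs : 𝔉.pre.BaseIsomorphic (Ψ.functor.obj 𝔉.AN) 𝔉.AN)
    (h51 : ∀ S T : C, 𝔉.IsFrobeniusTrivial S → 𝔉.IsFrobeniusTrivial T → 𝔉.pre.BaseIsomorphic S T →
      Nonempty (S ≅ T))
    (hpre : PreFrobenioidData.PreservesMor Ψ.functor 𝔉.IsPreStep 𝔉.IsPreStep)
    (hdiv : ∀ α : Ψ.functor.obj 𝔉.AN ≅ 𝔉.AN, ∃ ε : Aut 𝔉.AN,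
      𝔉.pre.div (α.inv ≫ Ψ.functor.map 𝔉.sCap) = 𝔉.pre.div (ε.hom ≫ 𝔉.sCap)) :
    𝔉.PreservesIsoClasses Ψ :=
  preservesIsoClasses_of Ψ hFT hΨFT hbs h51 hpre
    (fun φ φ' hφ hφ' h => by
      obtain ⟨f, -⟩ := exists_iso_of_div_eq hepi hiso hiiid hφ hφ' h
      exact ⟨f⟩)
    hdiv

end Appendix

end ThetaFrobenioid

end Literature.AnabelianGeometry.EtaleTheta
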